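import Literature.Barriers.NavierStokesRegularity.NavierStokesInequalityProfileBlock
import Literature.Analysis.FluidPDE.NormalisedPressureDisjointSum
import HarnessLib

/-!
# Scheffer's block for finitely many structures: Ożański's §6.3 Step 3 in space

Support file on the discharge path of fact D′
`Literature.Barriers.NavierStokesRegularity.NSICantorBlock_of_arrangement` (the level data of a
geometric arrangement for Theorem 14 = Ożański's Proposition 16, `NavierStokesInequalityCantorArrangement`).
W. S. Ożański, arXiv:1709.00602v4, §6.3 proves Proposition 16 at a fixed level `j` with the field
(6.22)

  `v(x,t) := Σ_{𝔪=1}^{𝔐} ( u[a₁^{𝔪,k}(t)v₁^𝔪, q₁^{𝔪,k}_t](x) + u[a₂^{𝔪,k}(t)v₂^𝔪, q₂^{𝔪,k}_t](x) )`,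

a FINITE sum of Scheffer's fields `u[w,g]` whose planar data live on pairwise disjoint sets
(`K^𝔪 = Ū₁^𝔪 ∪ Ū₂^𝔪` pairwise disjoint, Step 1), and verifies (i)–(iii) in **Step 3** (p. 31)
exactly as in the one-point §4.2 (the tree's `NavierStokesInequalityProfileBlock`, fact D-I =
Scheffer 1985, Lemma 2.1, for TWO structures): "Claim (i) is trivial"; the pressure function is
(6.23) `p̄(t) = Σ_𝔪 (p*[a₁v₁^𝔪,q₁^𝔪] + p*[a₂v₂^𝔪,q₂^𝔪])` "(recall (3.21) and Lemma 3.2 (iii))", so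
that `p̄(x,0,t) = Σ_𝔪 (p[…] + p[…])(x)` on `P`; and, fixing `x ∈ P`, `t ∈ [0,T]`:
**Case 1** (`φ₁^𝔪(x) + φ₂^𝔪(x) < 1` for all `𝔪`): `∂ₜ|v|² = Σ_𝔪(∂ₜ(q₁^𝔪)² + ∂ₜ(q₂^𝔪)²) ≤ 0 ≤
-v·∇(|v|² + 2p̄) + 2ν v·Δv` by (3.29)–(3.30); **Case 2** (`φ₁^𝔪(x) + φ₂^𝔪(x) = 1` for some `𝔪`):
`∂ₜ|v|² = ∂ₜ(q_i^𝔪)² ≤ -δ - a_i^𝔪v_i^𝔪·∇((q_i^𝔪)² + 2Σ_𝔫(p[a₁v₁^𝔫,q₁^𝔫] + p[a₂v₂^𝔫,q₂^𝔫]))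
= -δ - v·∇(|v|² + 2p̄) ≤ 2ν v·Δv - v·∇(|v|² + 2p̄)` for `ν ∈ [0,ν₀]`, using (6.26)
`ν₀|u[a v_i^𝔪,q_i^𝔪]·Δu[a v_i^𝔪,q_i^𝔪]| ≤ δ/4`.

This file PROVES that verification for an arbitrary finite family, indexed by a `Fintype ι`
(Ożański's `(i, 𝔪) ∈ {1,2} × {1,…,𝔐}`), of planar profile data — the `ι`-indexed version of the
tree's `IsNSIProfileData`/`isNSIBlock_profileField`, with the planar potential of piece `r`
carrying the pressures of ALL pieces and with the viscosity threshold `ν₀` GIVEN (as (4.13)/(6.26)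
require: one `ν₀` for all levels `j`) rather than produced by compactness:

* `multiProfileField v a Q t x = Σ_r u[a_r(t)v_r, Q_r(t)](x)` ((6.22)) and
  `multiProfilePotential v a Q r t = Q_r(t)² + 2Σ_{r'} p[a_{r'}v_{r'}, Q_{r'}]` (the planar scalar
  of Case 2);
* `IsNSIMultiProfileData U v T η δ C a Q` — the hypotheses: static planar data `(U_r, v_r)` from
  structures (`Ū_r ⋐ P` compact, `v_r ∈ C^∞`, `div(x₂v_r) = 0` on `U_r`) with PAIRWISE DISJOINT
  closures `Ū_r` (Step 1, (6.3)), directions `a_r ∈ C^∞(ℝ;[-1,1])`, closed `C_r ⊆ U_r` carrying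
  `supp v_r` (`{φ_r = 1}`), profiles `Q_r` jointly smooth on `(-η,T+η) × ℝ²`, `≥ 0`, `= 0` off
  `Ū_r`, `> |v_r|` on `U_r`, and for `t ∈ [0,T]` the planar inequalities of Cases 1–2:
  on `C_r`, `∂ₜQ_r² ≤ -δ - a_rv_r·∇(Q_r² + 2Σ_{r'}p[a_{r'}v_{r'},Q_{r'}])` ((6.25)); off `C_r`,
  `∂ₜQ_r² ≤ 0` and `Q_rL(Q_r) ≥ 0` on `P` ((6.24) with (3.29));
* PROVED: each slice is slice data (`slice`); localisation (`eventuallyEq_single`, at most one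
  piece is nonzero near any point); `|v| = Σ_r Q_r∘R⁻¹`, `|v|² = Σ_r Q_r²∘R⁻¹` (`norm_apply`,
  `norm_sq_apply`); `supp v(t) = ⋃_r R(Ū_r)` (`tsupport_eq`); joint smoothness on the slab
  (`isSmoothSpaceTimeOn`); `div v = 0` (`isDivFree`); the pressure (6.23)
  (`normalisedPressure_eq_sum`, from the tree's `normalisedPressure_sum_of_disjoint_of_contDiff`)
  and its planar trace; the transport term over `U_r` and off `⋃_r C_r`
  (`inner_gradient_energyPressure`, `…_eq_zero`); `v·Δv ≥ 0` off `⋃_r R(C_r)`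
  (`inner_laplacian_nonneg`); `∂ₜ|v|² = Σ_r ∂ₜQ_r² ∘ R⁻¹` (`timeDeriv_norm_sq`); and the
  **Navier–Stokes inequality** `nsi`: for every `ν ∈ [0,ν₀]`, `t ∈ [0,T]`, `x ∈ ℝ³`, provided
  `2ν₀ u_r·Δu_r ≥ -δ` for every piece ((6.26) in the form used).

## References

* W. S. Ożański, *On weak solutions to the Navier–Stokes inequality with internal
  singularities*, arXiv:1709.00602v4, §6.3 (Steps 1–3, (6.22)–(6.26)); §4.2 (Cases 1–2);
  Lemma 3.1, Lemma 3.2 (iii), (3.29)–(3.31). [`Ozanski2017NSISingular`]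
* V. Scheffer, *A solution to the Navier–Stokes inequality with an internal singularity*,
  Comm. Math. Phys. 101 (1985), Lemma 2.1 ((2.10)–(2.27)). [`Scheffer1985`]
* V. Scheffer, *Nearly one dimensional singularities of solutions to the Navier–Stokes
  inequality*, Comm. Math. Phys. 110 (1987), Lemma 5.5 with Lemmas 5.9–5.11. [`Scheffer1987`]
-/

noncomputable section

open MeasureTheory Set Function Filter Topology TopologicalSpace WithLp Metric
open scoped ENNReal InnerProductSpace RealInnerProductSpace ContDiff Laplacian

namespace Literature.Barriers.NavierStokesRegularity

open Literature.Analysis.FluidPDE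

/-- Local notation for physical space `ℝ³ = EuclideanSpace ℝ (Fin 3)`. -/
local notation "ℝ³" => EuclideanSpace ℝ (Fin 3)

variable {ι : Type*} [Fintype ι]

/-! ### The field (6.22) and the planar potential of Case 2 -/

/-- **The field of the level**, `v(x,t) = Σ_r u[a_r(t)v_r, Q_r(t)](x)` (Ożański (6.22):
`v = Σ_𝔪 (u[a₁^{𝔪,k}v₁^𝔪, q₁^{𝔪,k}] + u[a₂^{𝔪,k}v₂^𝔪, q₂^{𝔪,k}])`; Scheffer 1987, (5.32)), time
first. [cite: Ozanski2017NSISingular, §6.3 (6.22)] -/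
def multiProfileField (v : ι → ℝ × ℝ → ℝ × ℝ) (a : ι → ℝ → ℝ) (Q : ι → ℝ → ℝ × ℝ → ℝ) (t : ℝ)
    (x : ℝ³) : ℝ³ :=
  ∑ r, swirlField (a r t • v r) (Q r t) x

/-- **The planar potential of Case 2** for the piece `r`:
`Q_r(t)² + 2Σ_{r'} p[a_{r'}(t)v_{r'}, Q_{r'}(t)]` (Ożański (6.25): `(q_i^𝔪)² + 2Σ_𝔫(p[a₁v₁^𝔫,q₁^𝔫] +
p[a₂v₂^𝔫,q₂^𝔫])`, the other squares having vanishing gradient where `v_r ≠ 0`).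
[cite: Ozanski2017NSISingular, §6.3 (6.25)] -/
def multiProfilePotential (v : ι → ℝ × ℝ → ℝ × ℝ) (a : ι → ℝ → ℝ) (Q : ι → ℝ → ℝ × ℝ → ℝ)
    (r : ι) (t : ℝ) (q : ℝ × ℝ) : ℝ :=
  Q r t q ^ 2 + 2 * ∑ r', planePressure (a r' t • v r') (Q r' t) q

/-- Unfolding `multiProfileField`. [folklore] -/
theorem multiProfileField_apply (v : ι → ℝ × ℝ → ℝ × ℝ) (a : ι → ℝ → ℝ)
    (Q : ι → ℝ → ℝ × ℝ → ℝ) (t : ℝ) (x : ℝ³) :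
    multiProfileField v a Q t x = ∑ r, swirlField (a r t • v r) (Q r t) x := rfl

/-- The slice of the level field as a sum of functions. [folklore] -/
theorem multiProfileField_eq_sum (v : ι → ℝ × ℝ → ℝ × ℝ) (a : ι → ℝ → ℝ)
    (Q : ι → ℝ → ℝ × ℝ → ℝ) (t : ℝ) :
    multiProfileField v a Q t = ∑ r, swirlField (a r t • v r) (Q r t) := by
  funext x
  rw [multiProfileField_apply, Finset.sum_apply]

/-! ### Multi-profile data (Ożański 2017, §6.3 Steps 1–3) -/

/-- **Profile data for finitely many structures** — the hypotheses of Ożański's §6.3 Step 3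
(the `𝔐`-pair version of Scheffer's Lemma 2.1 / the tree's `IsNSIProfileData`), for a finite
family indexed by `r : ι` (printed `(i,𝔪)`, `i = 1,2`, `𝔪 = 1,…,𝔐`): static planar data — `Ū_r`
compact in the open half-plane `P`, `v_r ∈ C^∞` with `div(x₂v_r) = 0` on `U_r` (from the
structures `(v_r, ·, φ_r)` of Step 1) — with PAIRWISE DISJOINT closures (Step 1: "the sets `K^𝔪`
are pairwise disjoint", and `Ū₁ ∩ Ū₂ = ∅`); a margin `η > 0` (`(-η, T+η)`, printed `(-δ_k, T+δ_k)`);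
the slack `δ > 0` of (6.9)/(6.25); closed sets `C_r ⊆ U_r` with `supp v_r ⊆ C_r` (`{φ_r = 1}`);
directions `a_r ∈ C^∞(ℝ;[-1,1])` (the processes `a_i^{𝔪,k}`, Theorem 17); profiles
`Q_r : (-η,T+η) × ℝ² → [0,∞)` jointly smooth (`q_i^{𝔪,k} ∈ C^∞(P × (-δ_k,T+δ_k);[0,∞))`), `= 0`
off `Ū_r`, `> |v_r|` on `U_r` ("`(a_i^{𝔪,k}v_i^𝔪, q_i^{𝔪,k}, φ_i^𝔪)` is a structure on `U_i^𝔪`");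
and, for `t ∈ [0,T]`, the planar inequalities: on `C_r` (Case 2, (6.25))
`∂ₜQ_r² ≤ -δ - a_rv_r·∇(Q_r² + 2Σ_{r'}p[a_{r'}v_{r'},Q_{r'}])`; off `C_r` (Case 1, (6.24))
`∂ₜQ_r² ≤ 0`; and `Q_rL(Q_r) ≥ 0` on `P` off `C_r` ((3.29): `fLf ≥ 0` where `v = 0`).
[cite: Ozanski2017NSISingular, §6.3 Steps 1–3 ((6.22), (6.24)–(6.25))]
[cite: Scheffer1985, Lemma 2.1 (2.1)–(2.9)] -/
structure IsNSIMultiProfileData (U : ι → Set (ℝ × ℝ)) (v : ι → ℝ × ℝ → ℝ × ℝ) (T η δ : ℝ)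
    (C : ι → Set (ℝ × ℝ)) (a : ι → ℝ → ℝ) (Q : ι → ℝ → ℝ × ℝ → ℝ) : Prop where
  /-- `Ū_r` is compact, -/
  isCompact_closure : ∀ r, IsCompact (closure (U r))
  /-- `Ū_r ⊆ P`, -/
  closure_subset : ∀ r, closure (U r) ⊆ halfPlane
  /-- `v_r ∈ C^∞`, -/
  v_smooth : ∀ r, ContDiff ℝ ∞ (v r)
  /-- `div(x₂ v_r) = 0` on `U_r` (Definition 3.3). -/
  div_eq_zero : ∀ r, ∀ q ∈ U r,
    derivR (fun q' : ℝ × ℝ => q'.1 * (v r q').1) q + derivZ (fun q' : ℝ × ℝ => q'.1 * (v r q').2) q = 0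
  /-- The closures `Ū_r` are pairwise disjoint (Step 1). -/
  disjoint : Pairwise fun r r' => Disjoint (closure (U r)) (closure (U r'))
  /-- The time margin is positive. -/
  η_pos : 0 < η
  /-- The slack is positive. -/
  δ_pos : 0 < δ
  /-- The directions are smooth … -/
  a_smooth : ∀ r, ContDiff ℝ ∞ (a r)
  /-- … and bounded by one. -/
  abs_a_le : ∀ r t, |a r t| ≤ 1
  /-- `C_r` is closed, -/
  isClosed_C : ∀ r, IsClosed (C r)
  /-- `C_r ⊆ U_r`, -/
  C_subset : ∀ r, C r ⊆ U r
  /-- `supp v_r ⊆ C_r`. -/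
  tsupport_v : ∀ r, tsupport (v r) ⊆ C r
  /-- `Q_r` is jointly smooth on `(-η, T+η) × ℝ²`. -/
  Q_smooth : ∀ r, ContDiffOn ℝ ∞ (uncurry (Q r)) (Ioo (-η) (T + η) ×ˢ univ)
  /-- `Q_r ≥ 0`. -/
  Q_nonneg : ∀ r, ∀ t ∈ Ioo (-η) (T + η), ∀ q, 0 ≤ Q r t q
  /-- `Q_r(t) = 0` off `Ū_r`. -/
  Q_eq_zero : ∀ r, ∀ t ∈ Ioo (-η) (T + η), ∀ q ∉ closure (U r), Q r t q = 0
  /-- `Q_r(t) > |v_r|` on `U_r`. -/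
  sq_lt : ∀ r, ∀ t ∈ Ioo (-η) (T + η), ∀ q ∈ U r, (v r q).1 ^ 2 + (v r q).2 ^ 2 < Q r t q ^ 2
  /-- On `C_r`, `t ∈ [0,T]` (Case 2, (6.25)):
  `∂ₜ(Q_r²) ≤ -δ - a_rv_r·∇(Q_r² + 2Σ_{r'} p[a_{r'}v_{r'},Q_{r'}])`. -/
  inner : ∀ r, ∀ t ∈ Icc (0 : ℝ) T, ∀ q ∈ C r, deriv (fun s => Q r s q ^ 2) t ≤
    -δ - (a r t * (v r q).1 * derivR (multiProfilePotential v a Q r t) q +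
      a r t * (v r q).2 * derivZ (multiProfilePotential v a Q r t) q)
  /-- Off `C_r`, `t ∈ [0,T]` (Case 1, (6.24)): `∂ₜ(Q_r²) ≤ 0`. -/
  outer : ∀ r, ∀ t ∈ Icc (0 : ℝ) T, ∀ q ∉ C r, deriv (fun s => Q r s q ^ 2) t ≤ 0
  /-- Off `C_r` in `P`, `t ∈ [0,T]`: `Q_r L(Q_r) ≥ 0` ((3.29)). -/
  opL : ∀ r, ∀ t ∈ Icc (0 : ℝ) T, ∀ q ∉ C r, 0 < q.1 → 0 ≤ Q r t q * opL (Q r t) q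

namespace IsNSIMultiProfileData

variable {U : ι → Set (ℝ × ℝ)} {v : ι → ℝ × ℝ → ℝ × ℝ} {T η δ : ℝ} {C : ι → Set (ℝ × ℝ)}
  {a : ι → ℝ → ℝ} {Q : ι → ℝ → ℝ × ℝ → ℝ}

/-- `[0,T] ⊆ (-η, T+η)`. [folklore] -/
theorem Icc_subset (h : IsNSIMultiProfileData U v T η δ C a Q) :
    Icc (0 : ℝ) T ⊆ Ioo (-η) (T + η) := fun _ ht =>
  ⟨by linarith [h.η_pos, ht.1], by linarith [h.η_pos, ht.2]⟩

/-- `U_r ⊆ P`. [folklore] -/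
theorem subset_halfPlane (h : IsNSIMultiProfileData U v T η δ C a Q) (r : ι) : U r ⊆ halfPlane :=
  subset_closure.trans (h.closure_subset r)

/-- A point of `Ū_r` lies in no other `Ū_{r'}`. [cite: Ozanski2017NSISingular, §6.3 Step 1] -/
theorem notMem_closure_of_ne (h : IsNSIMultiProfileData U v T η δ C a Q) {r r' : ι} (hr : r' ≠ r)
    {q : ℝ × ℝ} (hq : q ∈ closure (U r)) : q ∉ closure (U r') :=
  Set.disjoint_right.1 (h.disjoint hr) hq

/-- `div(x₂ a v_r) = 0` on `U_r` for any scalar `a`. [folklore] -/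
theorem div_smul_eq_zero (h : IsNSIMultiProfileData U v T η δ C a Q) (r : ι) (b : ℝ) {q : ℝ × ℝ}
    (hq : q ∈ U r) :
    derivR (fun q' : ℝ × ℝ => q'.1 * ((b • v r) q').1) q +
      derivZ (fun q' : ℝ × ℝ => q'.1 * ((b • v r) q').2) q = 0 := by
  have h1 : (fun q' : ℝ × ℝ => q'.1 * ((b • v r) q').1) = fun q' => b * (q'.1 * (v r q').1) := by
    funext q'; simp; ring
  have h2 : (fun q' : ℝ × ℝ => q'.1 * ((b • v r) q').2) = fun q' => b * (q'.1 * (v r q').2) := by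
    funext q'; simp; ring
  have key := h.div_eq_zero r q hq
  have hv : Differentiable ℝ (v r) := (h.v_smooth r).differentiable (by simp)
  have hd1 : DifferentiableAt ℝ (fun q' : ℝ × ℝ => q'.1 * (v r q').1) q := by fun_prop
  have hd2 : DifferentiableAt ℝ (fun q' : ℝ × ℝ => q'.1 * (v r q').2) q := by fun_prop
  simp only [derivR, derivZ] at key ⊢
  rw [h1, h2, fderiv_const_mul hd1, fderiv_const_mul hd2]
  simp only [FunLike.coe_smul, Pi.smul_apply, smul_eq_mul]
  linear_combination b * key

/-! ### The slices -/

/-- **Each slice `(a_r(t)v_r, Q_r(t))`, `t ∈ (-η, T+η)`, is slice data on `U_r`** ("is a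
structure on `U_i^𝔪` for `t ∈ (-δ_k, T+δ_k)`"). [cite: Ozanski2017NSISingular, §6.3 Step 2] -/
theorem slice (h : IsNSIMultiProfileData U v T η δ C a Q) (r : ι) {t : ℝ}
    (ht : t ∈ Ioo (-η) (T + η)) : IsNSISlice (U r) (a r t • v r) (Q r t) where
  isCompact_closure := h.isCompact_closure r
  closure_subset := h.closure_subset r
  w_smooth := (h.v_smooth r).const_smul (a r t)
  g_smooth := IsSmoothSpaceTimeOn.contDiff_slice (h.Q_smooth r) ht
  g_nonneg := h.Q_nonneg r t ht
  tsupport_w := ((tsupport_smul_subset_right (fun _ : ℝ × ℝ => a r t) (v r)).trans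
    (h.tsupport_v r)).trans (h.C_subset r)
  g_eq_zero := h.Q_eq_zero r t ht
  sq_lt q hq := (IsNSIProfileData.sq_smul_le (h.abs_a_le r t) (v r) q).trans_lt (h.sq_lt r t ht q hq)
  div_eq_zero _ hq := h.div_smul_eq_zero r (a r t) hq

/-! ### Localisation: at most one piece is active near any point -/

/-- Off `Ū_r` the piece `r` vanishes. [cite: Ozanski2017NSISingular, §6.3 Step 1] -/
theorem swirlField_eq_zero (h : IsNSIMultiProfileData U v T η δ C a Q) {t : ℝ}
    (ht : t ∈ Ioo (-η) (T + η)) (r : ι) {x : ℝ³} (hx : meridian x ∉ closure (U r)) :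
    swirlField (a r t • v r) (Q r t) x = 0 :=
  (h.slice r ht).swirlField_eq_zero hx

/-- **At a point over `Ū_r`, `v = u[a_rv_r, Q_r]`** (all other pieces vanish there).
[cite: Ozanski2017NSISingular, §6.3 Step 3 (Case 2)] -/
theorem apply_of_mem (h : IsNSIMultiProfileData U v T η δ C a Q) {t : ℝ}
    (ht : t ∈ Ioo (-η) (T + η)) {r : ι} {x : ℝ³} (hx : meridian x ∈ closure (U r)) :
    multiProfileField v a Q t x = swirlField (a r t • v r) (Q r t) x := by
  rw [multiProfileField_apply]
  exact Finset.sum_eq_single r (fun r' _ hr' => h.swirlField_eq_zero ht r'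
    (h.notMem_closure_of_ne hr' hx)) (fun h' => (h' (Finset.mem_univ r)).elim)

/-- **Off `⋃_r R(Ū_r)`, `v = 0`.** [cite: Ozanski2017NSISingular, §6.3 Step 3 (Case 1)] -/
theorem apply_of_forall_notMem (h : IsNSIMultiProfileData U v T η δ C a Q) {t : ℝ}
    (ht : t ∈ Ioo (-η) (T + η)) {x : ℝ³} (hx : ∀ r, meridian x ∉ closure (U r)) :
    multiProfileField v a Q t x = 0 := by
  rw [multiProfileField_apply]
  exact Finset.sum_eq_zero fun r _ => h.swirlField_eq_zero ht r (hx r)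

/-- **Localisation**: near a point `x` lying over no `Ū_{r'}`, `r' ≠ r`, the field `v(t)` IS the
piece `u[a_rv_r, Q_r]` (the solids `R(Ū_{r'})` are closed and finitely many).
[cite: Ozanski2017NSISingular, §6.3 Step 3] -/
theorem eventuallyEq_single (h : IsNSIMultiProfileData U v T η δ C a Q) {t : ℝ}
    (ht : t ∈ Ioo (-η) (T + η)) (r : ι) {x : ℝ³} (hx : ∀ r', r' ≠ r → meridian x ∉ closure (U r')) :
    multiProfileField v a Q t =ᶠ[𝓝 x] swirlField (a r t • v r) (Q r t) := by
  have hev : ∀ᶠ y in 𝓝 x, ∀ r', r' ≠ r → meridian y ∉ closure (U r') := by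
    haveI : Finite ι := Finite.of_fintype ι
    rw [eventually_all]
    intro r'
    by_cases hr' : r' = r
    · exact Eventually.of_forall fun y h' => (h' hr').elim
    · have hO : IsOpen (revolve (closure (U r')))ᶜ :=
        (isClosed_closure.preimage continuous_meridian).isOpen_compl
      filter_upwards [hO.mem_nhds (hx r' hr')] with y hy _ using hy
  filter_upwards [hev] with y hy
  rw [multiProfileField_apply]
  exact Finset.sum_eq_single r (fun r' _ hr' => h.swirlField_eq_zero ht r' (hy r' hr'))
    (fun h' => (h' (Finset.mem_univ r)).elim)

/-- Localisation off all solids: near a point over no `Ū_r` the field vanishes identically. [folklore] -/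
theorem eventuallyEq_zero (h : IsNSIMultiProfileData U v T η δ C a Q) {t : ℝ}
    (ht : t ∈ Ioo (-η) (T + η)) {x : ℝ³} (hx : ∀ r, meridian x ∉ closure (U r)) :
    multiProfileField v a Q t =ᶠ[𝓝 x] fun _ => 0 := by
  have hev : ∀ᶠ y in 𝓝 x, ∀ r, meridian y ∉ closure (U r) := by
    haveI : Finite ι := Finite.of_fintype ι
    rw [eventually_all]
    intro r
    have hO : IsOpen (revolve (closure (U r)))ᶜ :=
      (isClosed_closure.preimage continuous_meridian).isOpen_compl
    filter_upwards [hO.mem_nhds (hx r)] with y hy using hy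
  filter_upwards [hev] with y hy
  exact h.apply_of_forall_notMem ht hy

/-! ### `|v| = Σ_r Q_r ∘ R⁻¹`, smoothness, support -/

/-- Off `Ū_r` the profile `Q_r(t)` vanishes at `R⁻¹x`; so at a point over `Ū_r` only the `r`-th
profile survives in `Σ_{r'} Q_{r'}(t)(R⁻¹x)`. [folklore] -/
theorem sum_Q_eq_of_mem (h : IsNSIMultiProfileData U v T η δ C a Q) {t : ℝ}
    (ht : t ∈ Ioo (-η) (T + η)) {r : ι} {q : ℝ × ℝ} (hq : q ∈ closure (U r)) (F : ℝ → ℝ)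
    (hF : F 0 = 0) : ∑ r', F (Q r' t q) = F (Q r t q) :=
  Finset.sum_eq_single r (fun r' _ hr' => by
    rw [h.Q_eq_zero r' t ht q (h.notMem_closure_of_ne hr' hq), hF])
    (fun h' => (h' (Finset.mem_univ r)).elim)

/-- **`|v(x,t)| = Σ_r Q_r(t)(R⁻¹x)`** for `t ∈ (-η, T+η)` (Ożański p. 31: "`|v(x,t)| =
Σ_𝔪 |q₁^{𝔪,k}(R⁻¹x) + q₂^{𝔪,k}(R⁻¹x)|` (recall that [the profiles] have disjoint supports)";
(3.11) `|u[v,f]| = f`). [cite: Ozanski2017NSISingular, §6.3 Step 3 (iv) and (3.11)] -/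
theorem norm_apply (h : IsNSIMultiProfileData U v T η δ C a Q) {t : ℝ} (ht : t ∈ Ioo (-η) (T + η))
    (x : ℝ³) : ‖multiProfileField v a Q t x‖ = ∑ r, Q r t (meridian x) := by
  by_cases hx : ∃ r, meridian x ∈ closure (U r)
  · obtain ⟨r, hr⟩ := hx
    rw [h.apply_of_mem ht hr, (h.slice r ht).norm_swirlField_eq]
    exact (h.sum_Q_eq_of_mem ht hr (fun y => y) rfl).symm
  · push Not at hx
    rw [h.apply_of_forall_notMem ht hx, norm_zero]
    exact (Finset.sum_eq_zero fun r _ => h.Q_eq_zero r t ht _ (hx r)).symm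

/-- **`|v(x,t)|² = Σ_r Q_r(t)(R⁻¹x)²`** for `t ∈ (-η, T+η)` (Scheffer (2.23)).
[cite: Scheffer1985, Lemma 2.1 (2.23)] [cite: Ozanski2017NSISingular, §6.3 Step 3] -/
theorem norm_sq_apply (h : IsNSIMultiProfileData U v T η δ C a Q) {t : ℝ}
    (ht : t ∈ Ioo (-η) (T + η)) (x : ℝ³) :
    ‖multiProfileField v a Q t x‖ ^ 2 = ∑ r, Q r t (meridian x) ^ 2 := by
  by_cases hx : ∃ r, meridian x ∈ closure (U r)
  · obtain ⟨r, hr⟩ := hx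
    rw [h.apply_of_mem ht hr, (h.slice r ht).norm_swirlField_eq,
      h.sum_Q_eq_of_mem ht hr (fun y => y ^ 2) (by norm_num)]
  · push Not at hx
    rw [h.apply_of_forall_notMem ht hx, norm_zero]
    symm
    rw [zero_pow two_ne_zero]
    exact Finset.sum_eq_zero fun r _ => by rw [h.Q_eq_zero r t ht _ (hx r)]; norm_num

/-- Each slice `v(t)`, `t ∈ (-η, T+η)`, is smooth. [cite: Ozanski2017NSISingular, §6.3 Step 3 (i)] -/
theorem contDiff (h : IsNSIMultiProfileData U v T η δ C a Q) {t : ℝ} (ht : t ∈ Ioo (-η) (T + η)) :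
    ContDiff ℝ ∞ (multiProfileField v a Q t) :=
  ContDiff.sum fun r _ => (h.slice r ht).contDiff_swirlField

/-- **`supp v(t) = ⋃_r R(Ū_r)`** for `t ∈ (-η, T+η)` (Ożański (i): `supp v^{(j)}(t) =
R(supp h_t^{(j)})`, p. 31: "`supp v(t) = ⋃_𝔪 R(K^𝔪)`").
[cite: Ozanski2017NSISingular, Prop. 16 (i) and §6.3 Step 3] -/
theorem tsupport_eq (h : IsNSIMultiProfileData U v T η δ C a Q) {t : ℝ} (ht : t ∈ Ioo (-η) (T + η)) :
    tsupport (multiProfileField v a Q t) = ⋃ r, revolve (closure (U r)) := by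
  haveI : Finite ι := Finite.of_fintype ι
  have hs : support (multiProfileField v a Q t) = ⋃ r, support (swirlField (a r t • v r) (Q r t)) := by
    ext x
    simp only [mem_support, mem_iUnion, ne_eq]
    constructor
    · intro hx
      by_contra hall
      push Not at hall
      exact hx (by rw [multiProfileField_apply]; exact Finset.sum_eq_zero fun r _ => hall r)
    · rintro ⟨r, hr⟩
      have hxr : meridian x ∈ closure (U r) := by
        by_contra h'
        exact hr (h.swirlField_eq_zero ht r h')
      rwa [h.apply_of_mem ht hxr]
  rw [tsupport, hs, closure_iUnion_of_finite]
  refine iUnion_congr fun r => ?_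
  exact (h.slice r ht).tsupport_swirlField

/-- `v(t)` has compact support. [cite: Ozanski2017NSISingular, Prop. 16 (i)] -/
theorem hasCompactSupport (h : IsNSIMultiProfileData U v T η δ C a Q) {t : ℝ}
    (ht : t ∈ Ioo (-η) (T + η)) : HasCompactSupport (multiProfileField v a Q t) := by
  rw [HasCompactSupport, h.tsupport_eq ht]
  exact isCompact_iUnion fun r => isCompact_revolve (h.isCompact_closure r)

/-- **`v ∈ C^∞(ℝ³ × (-η, T+η))`**: the level field is jointly smooth on the open slab (a finite
sum of the jointly smooth pieces, the tree's `isSmoothSpaceTimeOn_swirlField_param`).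
[cite: Ozanski2017NSISingular, §6.3 Step 3 (i) and §4.2 (first paragraph)] -/
theorem isSmoothSpaceTimeOn (h : IsNSIMultiProfileData U v T η δ C a Q) :
    IsSmoothSpaceTimeOn (Ioo (-η) (T + η)) (multiProfileField v a Q) := by
  have hr : ∀ r, IsSmoothSpaceTimeOn (Ioo (-η) (T + η))
      (fun t x => swirlField (a r t • v r) (Q r t) x) := fun r =>
    isSmoothSpaceTimeOn_swirlField_param (h.isCompact_closure r) (h.closure_subset r)
      (h.v_smooth r) ((h.tsupport_v r).trans (h.C_subset r)) (h.a_smooth r) (h.abs_a_le r)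
      (h.Q_smooth r) (h.Q_nonneg r) (h.Q_eq_zero r) (h.sq_lt r)
  have e : uncurry (multiProfileField v a Q) =
      fun p : ℝ × ℝ³ => ∑ r, uncurry (fun t x => swirlField (a r t • v r) (Q r t) x) p := by
    funext p
    rfl
  change ContDiffOn ℝ ∞ (uncurry (multiProfileField v a Q)) _
  rw [e]
  exact ContDiffOn.sum fun r _ => hr r

/-- **`div v(t) = 0`** for `t ∈ (-η, T+η)` (Lemma 3.1 (i) for each piece; "Claim (i) is trivial").
[cite: Ozanski2017NSISingular, Prop. 16 (i) and Lemma 3.1 (i)] -/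
theorem isDivFree (h : IsNSIMultiProfileData U v T η δ C a Q) {t : ℝ} (ht : t ∈ Ioo (-η) (T + η)) :
    VectorCalculus.IsDivFree (multiProfileField v a Q t) := by
  intro x
  have hd : ∀ r, DifferentiableAt ℝ (swirlField (a r t • v r) (Q r t)) x := fun r =>
    ((h.slice r ht).contDiff_swirlField.differentiable (by simp)) x
  have e : multiProfileField v a Q t = fun y => ∑ r, swirlField (a r t • v r) (Q r t) y := rfl
  rw [e, VectorCalculus.divergence, fderiv_fun_sum fun r _ => hd r, ContinuousLinearMap.toLinearMap_sum,
    map_sum]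
  exact Finset.sum_eq_zero fun r _ => (h.slice r ht).isDivFree_swirlField x

/-! ### The pressure (6.23) -/

/-- The field of the level is axisymmetric (a sum of axisymmetric fields `u[w,g]`).
[cite: Ozanski2017NSISingular, §3.3 (3.10)–(3.12)] -/
theorem isAxisymmetric (v : ι → ℝ × ℝ → ℝ × ℝ) (a : ι → ℝ → ℝ) (Q : ι → ℝ → ℝ × ℝ → ℝ) (t : ℝ) :
    IsAxisymmetric (multiProfileField v a Q t) := by
  intro θ x
  rw [multiProfileField_apply, multiProfileField_apply]
  have e : rotZ θ (∑ r, swirlField (a r t • v r) (Q r t) x) =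
      rotZLIE θ (∑ r, swirlField (a r t • v r) (Q r t) x) := rfl
  rw [e, map_sum]
  exact Finset.sum_congr rfl fun r _ => by rw [isAxisymmetric_swirlField _ _ θ x, rotZLIE_apply]

/-- The pressure function of the level field is an axisymmetric scalar ((3.8)).
[cite: Ozanski2017NSISingular, §3.2 (3.8)] -/
theorem isAxisymmetricScalar_normalisedPressure (v : ι → ℝ × ℝ → ℝ × ℝ) (a : ι → ℝ → ℝ)
    (Q : ι → ℝ → ℝ × ℝ → ℝ) (t : ℝ) :
    IsAxisymmetricScalar (normalisedPressure (multiProfileField v a Q t)) := fun θ x =>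
  normalisedPressure_comp_linearIsometryEquiv_of_equivariant (rotZLIE θ)
    (fun y => isAxisymmetric v a Q t θ y) x

/-- **(6.23): `p̄(t) = Σ_r p*[a_r(t)v_r, Q_r(t)]`** for `t ∈ (-η, T+η)` ("recall (3.21) and
Lemma 3.2 (iii)": the pieces are `C¹`, of finite energy, with pairwise disjoint supports — the
tree's `normalisedPressure_sum_of_disjoint_of_contDiff`). [cite: Ozanski2017NSISingular, §6.3 (6.23)] -/
theorem normalisedPressure_eq_sum (h : IsNSIMultiProfileData U v T η δ C a Q) {t : ℝ}
    (ht : t ∈ Ioo (-η) (T + η)) :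
    normalisedPressure (multiProfileField v a Q t) =
      ∑ r, normalisedPressure (swirlField (a r t • v r) (Q r t)) := by
  have hdisj : ∀ r ∈ (Finset.univ : Finset ι), ∀ r' ∈ (Finset.univ : Finset ι), r ≠ r' →
      ∀ y : ℝ³, swirlField (a r t • v r) (Q r t) y = 0 ∨ swirlField (a r' t • v r') (Q r' t) y = 0 := by
    intro r _ r' _ hrr' y
    by_cases hy : meridian y ∈ closure (U r)
    · exact Or.inr (h.swirlField_eq_zero ht r' (h.notMem_closure_of_ne (Ne.symm hrr') hy))
    · exact Or.inl (h.swirlField_eq_zero ht r hy)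
  have key := (normalisedPressure_sum_of_disjoint_of_contDiff Finset.univ
    (fun r => swirlField (a r t • v r) (Q r t)) hdisj
    (fun r _ => contDiff_infty.1 (h.slice r ht).contDiff_swirlField 1)
    (fun r _ => lintegral_enorm_sq_lt_top_of_hasCompactSupport
      (h.slice r ht).contDiff_swirlField.continuous (h.slice r ht).hasCompactSupport_swirlField)).2
  rw [multiProfileField_eq_sum]
  exact key

/-- **The planar trace of the pressure**: `p̄(x,0,t) = Σ_r p[a_r(t)v_r, Q_r(t)](x)` on the
meridian half-plane (Ożański, display after (6.23)). [cite: Ozanski2017NSISingular, §6.3 (6.23)] -/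
theorem normalisedPressure_meridianPoint (h : IsNSIMultiProfileData U v T η δ C a Q) {t : ℝ}
    (ht : t ∈ Ioo (-η) (T + η)) (q : ℝ × ℝ) :
    normalisedPressure (multiProfileField v a Q t) (meridianPoint q) =
      ∑ r, planePressure (a r t • v r) (Q r t) q := by
  rw [h.normalisedPressure_eq_sum ht, Finset.sum_apply]
  rfl

/-- `p̄(t) ∈ C^∞` for `t ∈ (-η, T+η)` ((3.21)). [cite: Ozanski2017NSISingular, §3.3 (3.21)] -/
theorem contDiff_normalisedPressure (h : IsNSIMultiProfileData U v T η δ C a Q) {t : ℝ}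
    (ht : t ∈ Ioo (-η) (T + η)) : ContDiff ℝ ∞ (normalisedPressure (multiProfileField v a Q t)) :=
  contDiff_normalisedPressure_of_contDiff_infty (h.contDiff ht) (h.hasCompactSupport ht)

/-! ### The scalar `|v|² + 2p̄` -/

/-- The scalar `|v(t)|² + 2p̄(t)` is axisymmetric. [cite: Ozanski2017NSISingular, §3.2 (3.8)] -/
theorem isAxisymmetricScalar_energyPressure (h : IsNSIMultiProfileData U v T η δ C a Q) {t : ℝ}
    (ht : t ∈ Ioo (-η) (T + η)) :
    IsAxisymmetricScalar fun y => ‖multiProfileField v a Q t y‖ ^ 2 +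
      2 * normalisedPressure (multiProfileField v a Q t) y := by
  intro θ y
  have hp := isAxisymmetricScalar_normalisedPressure v a Q t θ y
  simp only
  rw [h.norm_sq_apply ht, h.norm_sq_apply ht, meridian_rotZ, hp]

/-- The scalar `|v(t)|² + 2p̄(t)` is differentiable. [folklore] -/
theorem differentiable_energyPressure (h : IsNSIMultiProfileData U v T η δ C a Q) {t : ℝ}
    (ht : t ∈ Ioo (-η) (T + η)) :
    Differentiable ℝ fun y => ‖multiProfileField v a Q t y‖ ^ 2 +
      2 * normalisedPressure (multiProfileField v a Q t) y :=
  (((h.contDiff ht).differentiable (by simp)).norm_sq ℝ).add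
    (((h.contDiff_normalisedPressure ht).differentiable (by simp)).const_mul 2)

/-- **The planar trace of `|v|² + 2p̄` near a point of `U_r`** is the planar potential
`Q_r² + 2Σ_{r'} p[a_{r'}v_{r'}, Q_{r'}]` (all other squares vanish near `q`).
[cite: Ozanski2017NSISingular, §6.3 Step 3 (Case 2)] [cite: Scheffer1985, Lemma 2.1 (2.16)–(2.17)] -/
theorem energyPressure_meridianPoint_eventuallyEq (h : IsNSIMultiProfileData U v T η δ C a Q)
    {t : ℝ} (ht : t ∈ Ioo (-η) (T + η)) {r : ι} {q : ℝ × ℝ} (hq : q ∈ U r) :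
    (fun q' => ‖multiProfileField v a Q t (meridianPoint q')‖ ^ 2 +
        2 * normalisedPressure (multiProfileField v a Q t) (meridianPoint q')) =ᶠ[𝓝 q]
      multiProfilePotential v a Q r t := by
  haveI : Finite ι := Finite.of_fintype ι
  have hq1 : 0 < q.1 := h.subset_halfPlane r hq
  have hev : ∀ᶠ q' in 𝓝 q, ∀ r', r' ≠ r → q' ∉ closure (U r') := by
    rw [eventually_all]
    intro r'
    by_cases hr' : r' = r
    · exact Eventually.of_forall fun y h' => (h' hr').elim
    · filter_upwards [isClosed_closure.isOpen_compl.mem_nhds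
        (h.notMem_closure_of_ne hr' (subset_closure hq))] with q' hq' _ using hq'
  filter_upwards [(isOpen_lt continuous_const continuous_fst).mem_nhds hq1, hev] with q' hq' hq'2
  rw [h.norm_sq_apply ht, h.normalisedPressure_meridianPoint ht, meridian_meridianPoint (le_of_lt hq'),
    multiProfilePotential, Finset.sum_eq_single r (fun r' _ hr' => by
      rw [h.Q_eq_zero r' t ht q' (hq'2 r' hr')]; norm_num) (fun h' => (h' (Finset.mem_univ r)).elim)]

/-! ### The transport term -/

/-- **The transport term over `U_r`** (Case 2; Scheffer (2.25); the pairing of `u[v,f]` with the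
gradient of an axisymmetric scalar is the planar pairing, (4.35)): for `t ∈ (-η,T+η)` and
`R⁻¹x = q ∈ U_r`,
`v·∇(|v|² + 2p̄)(x,t) = a_r(t)v_r(q)·∇(Q_r(t)² + 2Σ_{r'}p[a_{r'}v_{r'},Q_{r'}])(q)`.
[cite: Ozanski2017NSISingular, §6.3 Step 3 (Case 2) and (4.35)] [cite: Scheffer1985, Lemma 2.1 (2.25)] -/
theorem inner_gradient_energyPressure (h : IsNSIMultiProfileData U v T η δ C a Q) {t : ℝ}
    (ht : t ∈ Ioo (-η) (T + η)) {r : ι} {x : ℝ³} (hx : meridian x ∈ U r) :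
    ⟪multiProfileField v a Q t x,
        gradient (fun y => ‖multiProfileField v a Q t y‖ ^ 2 +
          2 * normalisedPressure (multiProfileField v a Q t) y) x⟫ =
      a r t * (v r (meridian x)).1 * derivR (multiProfilePotential v a Q r t) (meridian x) +
        a r t * (v r (meridian x)).2 * derivZ (multiProfilePotential v a Q r t) (meridian x) := by
  have hq1 : 0 < (meridian x).1 := h.subset_halfPlane r hx
  have hxr : cylRadius x ≠ 0 := hq1.ne'
  have hloc := h.energyPressure_meridianPoint_eventuallyEq ht hx
  rw [h.apply_of_mem ht (subset_closure hx),
    inner_swirlField_gradient (h.isAxisymmetricScalar_energyPressure ht) _ _ hxr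
      (h.differentiable_energyPressure ht x), derivR, derivZ, hloc.fderiv_eq]
  simp only [Pi.smul_apply, Prod.smul_fst, Prod.smul_snd, smul_eq_mul, derivR, derivZ, mul_assoc]

/-- **The transport term vanishes off `⋃_r R(C_r)`** (Case 1; (3.30): `u[v,f]·∇Q = 0` where
`v = 0`; Scheffer (2.26)). [cite: Ozanski2017NSISingular, §3.4 (3.30)] [cite: Scheffer1985, Lemma 2.1 (2.26)] -/
theorem inner_gradient_energyPressure_eq_zero (h : IsNSIMultiProfileData U v T η δ C a Q) {t : ℝ}
    (ht : t ∈ Ioo (-η) (T + η)) {x : ℝ³} (hx : ∀ r, meridian x ∉ C r) :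
    ⟪multiProfileField v a Q t x,
        gradient (fun y => ‖multiProfileField v a Q t y‖ ^ 2 +
          2 * normalisedPressure (multiProfileField v a Q t) y) x⟫ = 0 := by
  have hax := h.isAxisymmetricScalar_energyPressure ht
  rw [multiProfileField_apply, sum_inner]
  refine Finset.sum_eq_zero fun r _ => ?_
  have hv : (a r t • v r) (meridian x) = 0 := by
    rw [Pi.smul_apply, image_eq_zero_of_notMem_tsupport fun h' => hx r (h.tsupport_v r h'), smul_zero]
  exact inner_swirlField_gradient_eq_zero hax _ _ hv

/-! ### The viscous term -/

/-- **`v·Δv ≥ 0` off `⋃_r R(C_r)`** for `t ∈ [0,T]` (Case 1 with (3.29): near such a point `v`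
is a single piece `u[a_rv_r,Q_r]` with `R⁻¹x ∉ supp v_r`, so `v·Δv = Q_rL(Q_r) ∘ R⁻¹ ≥ 0`, or
`v ≡ 0` near `x`). [cite: Ozanski2017NSISingular, §6.3 Step 3 (Case 1) and (3.29)]
[cite: Scheffer1985, Lemma 2.1 (2.19)–(2.22)] -/
theorem inner_laplacian_nonneg (h : IsNSIMultiProfileData U v T η δ C a Q) {t : ℝ}
    (ht : t ∈ Icc (0 : ℝ) T) {x : ℝ³} (hx : ∀ r, meridian x ∉ C r) :
    0 ≤ ⟪multiProfileField v a Q t x, (Δ (multiProfileField v a Q t)) x⟫ := by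
  have htJ := h.Icc_subset ht
  by_cases h1 : ∃ r, meridian x ∈ closure (U r)
  · obtain ⟨r, hr⟩ := h1
    have hloc := h.eventuallyEq_single htJ r fun r' hr' => h.notMem_closure_of_ne hr' hr
    have hrad : cylRadius x ≠ 0 := ne_of_gt (h.closure_subset r hr)
    have hq : meridian x ∉ tsupport (a r t • v r) := fun h' =>
      hx r (h.tsupport_v r (tsupport_smul_subset_right (fun _ => a r t) (v r) h'))
    rw [(InnerProductSpace.laplacian_congr_nhds hloc).self_of_nhds, hloc.self_of_nhds,
      (h.slice r htJ).inner_swirlField_laplacian_eq hrad hq]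
    exact h.opL r t ht _ (hx r) (h.closure_subset r hr)
  · push Not at h1
    rw [h.apply_of_forall_notMem htJ h1, inner_zero_left]

/-- **Over `Ū_r` the viscous term is that of the piece**: `v·Δv(x,t) = u_r·Δu_r(x,t)`,
`u_r = u[a_rv_r,Q_r]`, for `R⁻¹x ∈ Ū_r` (locality of `Δ`). [cite: Ozanski2017NSISingular, §6.3 Step 3 (Case 2)] -/
theorem inner_laplacian_eq_of_mem (h : IsNSIMultiProfileData U v T η δ C a Q) {t : ℝ}
    (ht : t ∈ Ioo (-η) (T + η)) {r : ι} {x : ℝ³} (hx : meridian x ∈ closure (U r)) :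
    ⟪multiProfileField v a Q t x, (Δ (multiProfileField v a Q t)) x⟫ =
      ⟪swirlField (a r t • v r) (Q r t) x, (Δ (swirlField (a r t • v r) (Q r t))) x⟫ := by
  have hloc := h.eventuallyEq_single ht r fun r' hr' => h.notMem_closure_of_ne hr' hx
  rw [(InnerProductSpace.laplacian_congr_nhds hloc).self_of_nhds, hloc.self_of_nhds]

/-! ### The time derivative of `|v|²` -/

/-- Each time line `s ↦ Q_r(s)(q)` is differentiable at `t ∈ (-η, T+η)`. [folklore] -/
theorem differentiableAt_Q (h : IsNSIMultiProfileData U v T η δ C a Q) (r : ι) {t : ℝ}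
    (ht : t ∈ Ioo (-η) (T + η)) (q : ℝ × ℝ) : DifferentiableAt ℝ (fun s => Q r s q) t :=
  ((IsSmoothSpaceTimeOn.hasDerivWithinAt_time (h.Q_smooth r) ht q).hasDerivAt
    (Ioo_mem_nhds ht.1 ht.2)).differentiableAt

/-- **`∂ₜ|v|²(x,t) = Σ_r ∂ₜ(Q_r²)(t, R⁻¹x)`** for `t ∈ (-η, T+η)` (Step 3: "`∂ₜ|v(x,0,t)|² =
Σ_𝔪(∂ₜq₁^{𝔪,k}(x)² + ∂ₜq₂^{𝔪,k}(x)²)`"). [cite: Ozanski2017NSISingular, §6.3 Step 3 (Cases 1–2)] -/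
theorem timeDeriv_norm_sq (h : IsNSIMultiProfileData U v T η δ C a Q) {t : ℝ}
    (ht : t ∈ Ioo (-η) (T + η)) (x : ℝ³) :
    timeDeriv (fun s y => ‖multiProfileField v a Q s y‖ ^ 2) t x =
      ∑ r, deriv (fun s => Q r s (meridian x) ^ 2) t := by
  rw [timeDeriv_apply]
  have he : (fun s => ‖multiProfileField v a Q s x‖ ^ 2) =ᶠ[𝓝 t]
      fun s => ∑ r, Q r s (meridian x) ^ 2 := by
    filter_upwards [Ioo_mem_nhds ht.1 ht.2] with s hs
    exact h.norm_sq_apply hs x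
  rw [he.deriv_eq]
  exact (HasDerivAt.fun_sum fun r _ => ((h.differentiableAt_Q r ht (meridian x)).pow 2).hasDerivAt).deriv

/-- Off `Ū_r` the profile `Q_r` is frozen: `∂ₜ(Q_r²)(t,q) = 0` for `q ∉ Ū_r`, `t ∈ (-η,T+η)`.
[cite: Scheffer1985, Lemma 2.1 (2.4)] -/
theorem deriv_Q_sq_eq_zero (h : IsNSIMultiProfileData U v T η δ C a Q) (r : ι) {t : ℝ}
    (ht : t ∈ Ioo (-η) (T + η)) {q : ℝ × ℝ} (hq : q ∉ closure (U r)) :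
    deriv (fun s => Q r s q ^ 2) t = 0 := by
  have he : (fun s => Q r s q ^ 2) =ᶠ[𝓝 t] fun _ => (0 : ℝ) := by
    filter_upwards [Ioo_mem_nhds ht.1 ht.2] with s hs
    rw [h.Q_eq_zero r s hs q hq]
    norm_num
  rw [he.deriv_eq, deriv_const]

/-- Over `Ū_r` only the `r`-th profile moves: `∂ₜ|v|²(x,t) = ∂ₜ(Q_r²)(t,R⁻¹x)` for `R⁻¹x ∈ Ū_r`.
[cite: Ozanski2017NSISingular, §6.3 Step 3 (Case 2)] -/
theorem timeDeriv_norm_sq_of_mem (h : IsNSIMultiProfileData U v T η δ C a Q) {t : ℝ}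
    (ht : t ∈ Ioo (-η) (T + η)) {r : ι} {x : ℝ³} (hx : meridian x ∈ closure (U r)) :
    timeDeriv (fun s y => ‖multiProfileField v a Q s y‖ ^ 2) t x =
      deriv (fun s => Q r s (meridian x) ^ 2) t := by
  rw [h.timeDeriv_norm_sq ht]
  exact Finset.sum_eq_single r (fun r' _ hr' => h.deriv_Q_sq_eq_zero r' ht
    (h.notMem_closure_of_ne hr' hx)) (fun h' => (h' (Finset.mem_univ r)).elim)

/-! ### The Navier–Stokes inequality (6.24)–(6.26) -/

/-- **The pointwise Navier–Stokes inequality for the level field** (Ożański 2017, §6.3 Step 3,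
Cases 1–2; Scheffer 1985, Lemma 2.1): if `2ν₀ u_r·Δu_r ≥ -δ` on `[0,T] × ℝ³` for every piece
`u_r = u[a_rv_r, Q_r]` ((6.26): `ν₀|u[a v_i^𝔪,q_i^{𝔪,k}]·Δu[a v_i^𝔪,q_i^{𝔪,k}]| ≤ δ/4`, of which
only the lower bound is used), then for every `ν ∈ [0,ν₀]`, `t ∈ [0,T]`, `x ∈ ℝ³`,
`∂ₜ|v|² ≤ -v·∇(|v|² + 2p̄) + 2ν v·Δv`. At `q = R⁻¹x`: for `q ∈ C_r` (Case 2),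
`∂ₜ|v|² = ∂ₜQ_r² ≤ -δ - a_rv_r·∇Φ_r = -δ - v·∇(|v|² + 2p̄) ≤ -v·∇(|v|² + 2p̄) + 2ν v·Δv`; for
`q ∉ ⋃_r C_r` (Case 1), `∂ₜ|v|² = Σ_r ∂ₜQ_r² ≤ 0`, the transport term vanishes and `v·Δv ≥ 0`.
[cite: Ozanski2017NSISingular, §6.3 Step 3 ((6.24)–(6.26))] [cite: Scheffer1985, Lemma 2.1] -/
theorem nsi (h : IsNSIMultiProfileData U v T η δ C a Q) {ν₀ : ℝ}
    (hvisc : ∀ r, ∀ t ∈ Icc (0 : ℝ) T, ∀ x : ℝ³,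
      -δ ≤ 2 * ν₀ * ⟪swirlField (a r t • v r) (Q r t) x, (Δ (swirlField (a r t • v r) (Q r t))) x⟫)
    {ν : ℝ} (hν : ν ∈ Icc (0 : ℝ) ν₀) {t : ℝ} (ht : t ∈ Icc (0 : ℝ) T) (x : ℝ³) :
    timeDeriv (fun s y => ‖multiProfileField v a Q s y‖ ^ 2) t x ≤
      -⟪multiProfileField v a Q t x, gradient (fun y => ‖multiProfileField v a Q t y‖ ^ 2 +
          2 * normalisedPressure (multiProfileField v a Q t) y) x⟫ +
        2 * ν * ⟪multiProfileField v a Q t x, (Δ (multiProfileField v a Q t)) x⟫ := by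
  have htJ := h.Icc_subset ht
  by_cases hC : ∃ r, meridian x ∈ C r
  · -- Case 2 over `U_r`
    obtain ⟨r, hr⟩ := hC
    have hU : meridian x ∈ U r := h.C_subset r hr
    have hcl : meridian x ∈ closure (U r) := subset_closure hU
    set L := ⟪swirlField (a r t • v r) (Q r t) x, (Δ (swirlField (a r t • v r) (Q r t))) x⟫ with hL
    -- the slack absorbs the viscous term: `-δ ≤ 2ν u_r·Δu_r`
    have hvisc' : -δ ≤ 2 * ν * L := by
      have h0 := hvisc r t ht x
      rcases le_or_gt 0 L with hL0 | hL0
      · have : 0 ≤ 2 * ν * L := mul_nonneg (mul_nonneg two_pos.le hν.1) hL0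
        linarith [h.δ_pos]
      · have : 2 * ν₀ * L ≤ 2 * ν * L := by nlinarith [hν.1, hν.2]
        linarith
    rw [h.timeDeriv_norm_sq_of_mem htJ hcl, h.inner_gradient_energyPressure htJ hU,
      h.inner_laplacian_eq_of_mem htJ hcl]
    have hin := h.inner r t ht _ hr
    linarith
  · -- Case 1: off `⋃_r R(C_r)`
    push Not at hC
    rw [h.inner_gradient_energyPressure_eq_zero htJ hC, neg_zero, zero_add, h.timeDeriv_norm_sq htJ]
    have h1 : ∑ r, deriv (fun s => Q r s (meridian x) ^ 2) t ≤ 0 :=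
      Finset.sum_nonpos fun r _ => h.outer r t ht _ (hC r)
    have h3 : 0 ≤ ⟪multiProfileField v a Q t x, (Δ (multiProfileField v a Q t)) x⟫ :=
      h.inner_laplacian_nonneg ht hC
    have h4 : 0 ≤ 2 * ν * ⟪multiProfileField v a Q t x, (Δ (multiProfileField v a Q t)) x⟫ :=
      mul_nonneg (mul_nonneg two_pos.le hν.1) h3
    linarith

end IsNSIMultiProfileData

end Literature.Barriers.NavierStokesRegularity
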